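import Summits.BirchSwinnertonDyer.BirchSwinnertonDyer.Theorems.KolyvaginRankRigidityAtTwoKolyvaginCorankRigidityAtTwoLowerBoundOfProp37OfBoundedDefect
import Literature.NumberTheory.EllipticCurves.ModularityVersionApProofs
import Literature.NumberTheory.EllipticCurves.Rank1Residual.X11Three
import HarnessLib

/-!
# Crux V2 `KolyvaginCorankRigidityAtTwo` (stmt-BirchSwinnertonDyer-23949), line `kolyvagin_depth_split`, OPEN stub
# `stub_lowerBoundMinimalPosDepth`: the MULTIPLICATIVE-at-`2` branch needs no `2`-split binder — it follows from
# Gross 1991 Prop. 3.7 (2) and U1 `KolyvaginBoundedDefectAtTwo` (stmt-28083) alone; the uncovered residue of the stub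
# is exactly «good ordinary at `2` ∧ `2` inert in `K` (`d_K ≡ 5 (mod 8)`)»

Helper file (`--supports stmt-BirchSwinnertonDyer-23949 --as helper`), THEOREMS ONLY (no definition, no `sorry`).

The previous certificate `KolyvaginRankRigidity.lowerBoundMinimalPosDepth_of_prop37_of_boundedDefect` (p795646)
proves the registered stub's signature from the print fact `GrossLMS1991.prop37_2_frobeniusCongruence` and the
open crux U1, but with ONE EXTRA binder `SatisfiesHeegnerHypothesis 2 K` (needed because U1 lives on the 2-split
frame).  This file removes that binder on the half of the stub's habitat where it is automatic:

* `satisfiesHeegnerHypothesis_two_of_mult` — if `W` (elliptic, over `ℚ`) has multiplicative reduction at `2`, then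
  `2 ∣ N_W` (`WeierstrassCurve.dvd_conductorNorm_iff_not_hasGoodReductionAtPrime`, Diamond–Shurman §8.3 /
  Silverman ATAEC IV.10.2 (a), a tree theorem) so the Heegner hypothesis for `N_W` already makes `2` split in `K`
  (`SatisfiesHeegnerHypothesis.of_dvd`);
* `lowerBoundMinimalPosDepth_of_prop37_of_boundedDefect_of_mult` — hence in the `Mult W 2` branch the stub's
  signature (all other binders verbatim, the disjunction `GoodOrd W 2 ∨ Mult W 2` specialised to its second
  member) follows from Prop. 3.7 (2) ∧ U1 with NO extra binder;
* `lowerBoundMinimalPosDepth_of_prop37_of_boundedDefect_of_inertSupplier` — the stub's FULL registered signature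
  (no extra binder) from Prop. 3.7 (2), U1 and ONE residual hypothesis `hInert` = V1′∞'s conclusion («some depth
  is rich») on the frames «good ordinary at `2`, `2` not split in `K`», all other binders V1′∞'s verbatim: the
  exact missing supplier, as a Lean signature, for the planner.

Consequently the part of `stub_lowerBoundMinimalPosDepth` NOT covered by «Prop37 ∧ U1» is exactly the sub-case
`GoodOrd W 2` with `2` inert in `K` (odd `d_K`, so `d_K ≡ 5 (mod 8)`), for which the route has no rich-depth
supplier item (U1, U2, V1′∞ all carry the `2`-split clause) — `hInert` above is that supplier's statement.
HONEST FRAMING: CONDITIONAL on the named print fact (conditional-result), on the OPEN crux U1 and (third theorem)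
on the unfiled research statement `hInert`; closes no stub; BSD is NOT proved for any curve.

References (locators only): [cite: GrossLMS1991, Prop. 3.7 (2)] [cite: Kolyvagin1991MathAnn, §2 Thm. 2.2, Conj. 2.5]
[cite: DiamondShurman2005, §8.3] [cite: SilvermanAEC2009, VII.5 Prop. 5.1].
-/

set_option autoImplicit false
-- the Theorems namespace of this sub repeats the summit name by design (D-0017 nested layout)
set_option linter.dupNamespace false

noncomputable section

open scoped Classical

open WeierstrassCurve Literature.NumberTheory.EllipticCurves
  Literature.NumberTheory.EllipticCurves.ModularForms
open Summit.BirchSwinnertonDyer.BirchSwinnertonDyer.Theses.KolyvaginRankRigidityAtTwo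
open Summit.BirchSwinnertonDyer.BirchSwinnertonDyer.Theorems

namespace Summit.BirchSwinnertonDyer.BirchSwinnertonDyer.Theorems.KolyvaginRankRigidity

/-- **Multiplicative reduction at `2` forces `2` to split in a Heegner field.** For an elliptic `W/ℚ` with
multiplicative reduction at `2`, `2` is a prime of bad reduction, so `2 ∣ N_W`
(`dvd_conductorNorm_iff_not_hasGoodReductionAtPrime`); the Heegner hypothesis for `N_W` is inherited by the divisor
`2` (`SatisfiesHeegnerHypothesis.of_dvd`). [cite: DiamondShurman2005, §8.3] [cite: GrossLMS1991, §1 (p. 235)] -/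
theorem satisfiesHeegnerHypothesis_two_of_mult (W : WeierstrassCurve ℚ) [W.IsElliptic]
    (hmult : Rank1Residual.Mult W 2) {K : Type} [Field K]
    (hH : SatisfiesHeegnerHypothesis (W.conductorNorm ℤ) K) : SatisfiesHeegnerHypothesis 2 K :=
  SatisfiesHeegnerHypothesis.of_dvd
    ((W.dvd_conductorNorm_iff_not_hasGoodReductionAtPrime 2).mpr
      (Rank1Residual.not_hasGoodReductionAtPrime_of_hasMultiplicativeReductionAtPrime 2 hmult)) hH

/-- **`stub_lowerBoundMinimalPosDepth` in the multiplicative-at-`2` branch, from Gross 1991 Prop. 3.7 (2) and U1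
alone, with NO extra binder.** CONDITIONAL on the named print fact `GrossLMS1991.prop37_2_frobeniusCongruence`
(cite-only in the tree) and on the OPEN crux U1 `KolyvaginBoundedDefectAtTwo` (stmt-28083): the registered stub's
signature with `GoodOrd W 2 ∨ Mult W 2` specialised to `Mult W 2`; the `2`-split clause that U1 needs is supplied by
`satisfiesHeegnerHypothesis_two_of_mult`, everything else is `lowerBoundMinimalPosDepth_of_prop37_of_boundedDefect`
(p795646).  Closes nothing; BSD is not proved. [cite: GrossLMS1991, Prop. 3.7 (2)]
[cite: Kolyvagin1991MathAnn, §2 Thm. 2.2, Conj. 2.5] -/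
theorem lowerBoundMinimalPosDepth_of_prop37_of_boundedDefect_of_mult
    (h37 : Literature.NumberTheory.EllipticCurves.GrossLMS1991.prop37_2_frobeniusCongruence)
    (hU1 : KolyvaginBoundedDefectAtTwo) :
    ∀ (W : WeierstrassCurve ℚ) [W.IsElliptic] [W.IsGloballyMinimal], ¬ W.HasCM →
      Rank1Residual.Mult W 2 →
      (∀ m : ℕ, W.HasSurjectiveModNGaloisRep (2 ^ m : ℕ)) →
      ∀ (K : Type) [Field K] [NumberField K], IsImaginaryQuadratic K → NumberField.discr K ≠ -3 →
      NumberField.discr K ≠ -4 → ¬ ((2 : ℤ) ∣ NumberField.discr K) → ∀ [NeZero (W.conductorNorm ℤ)],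
      SatisfiesHeegnerHypothesis (W.conductorNorm ℤ) K →
      ∀ (Dt : ModularParametrizationData W (W.conductorNorm ℤ)) (β : ℤ) (ι : K →+* ℂ) (n : ℕ)
        (d : KolyvaginHeegnerData Dt β ι n) (M : ℕ),
        KolyvaginDescent.KolSupp (Zhang2014.IsKolyvaginPrime (W.conductorNorm ℤ) W K 2) n →
        1 ≤ M → (M : ℕ∞) ≤ Zhang2014.levelIndex W 2 n → d.kolyvaginClass Nat.prime_two M ≠ 0 →
        (∀ (n' : ℕ) (d' : KolyvaginHeegnerData Dt β ι n') (M' : ℕ),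
          KolyvaginDescent.KolSupp (Zhang2014.IsKolyvaginPrime (W.conductorNorm ℤ) W K 2) n' →
          1 ≤ M' → (M' : ℕ∞) ≤ Zhang2014.levelIndex W 2 n' → d'.kolyvaginClass Nat.prime_two M' ≠ 0 →
          n.primeFactors.card ≤ n'.primeFactors.card) →
        1 ≤ n.primeFactors.card →
        (n.primeFactors.card + 1 ≤ W.selmerCorank 2 ∨
          n.primeFactors.card + 1 ≤ (W.quadraticTwist (NumberField.discr K : ℚ)).selmerCorank 2) := by
  intro W _ _ hCM hmult hsur K _ _ hK hne3 hne4 h2d _ hHN Dt β ι n d M hn hM1 hMle hne hmin hpos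
  exact lowerBoundMinimalPosDepth_of_prop37_of_boundedDefect h37 hU1 W hCM (Or.inr hmult) hsur K hK hne3
    hne4 h2d hHN (satisfiesHeegnerHypothesis_two_of_mult W hmult hHN) Dt β ι n d M hn hM1 hMle hne hmin hpos

/-- **The registered stub's FULL signature (no extra binder) from Prop. 3.7 (2), U1 and ONE residual supplier — the
exact missing piece as a Lean signature.**  `hInert` is V1′∞'s conclusion («some depth is rich») on the frames that
neither U1 nor any other route item reaches: good ORDINARY at `2` with `2` NOT split in `K` (for the stub's odd `d_K`:
`d_K ≡ 5 (mod 8)`); its other binders are V1′∞'s, verbatim.  Proof: split on `SatisfiesHeegnerHypothesis 2 K`; if it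
holds, `lowerBoundMinimalPosDepth_of_prop37_of_boundedDefect` (p795646); if not, the reduction at `2` is good ordinary
(`satisfiesHeegnerHypothesis_two_of_mult` excludes the multiplicative branch), `hInert` gives a rich depth and V2♭∞
(`KolyvaginLowerBoundAtTwo.KolyvaginCorankLowerBoundAtTwoRich_of_prop37`, p641767) is applied at the least rich depth
(`lowerBound_of_rich_of_exists_richDepth`, p794602).  CONDITIONAL on the print fact, on the OPEN crux U1 and on the
unfiled research statement `hInert`; closes nothing; BSD is not proved. [cite: GrossLMS1991, Prop. 3.7 (2)]
[cite: Kolyvagin1991MathAnn, §2 Thm. 2.2, (2.1), Conj. 2.5] -/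
theorem lowerBoundMinimalPosDepth_of_prop37_of_boundedDefect_of_inertSupplier
    (h37 : Literature.NumberTheory.EllipticCurves.GrossLMS1991.prop37_2_frobeniusCongruence)
    (hU1 : KolyvaginBoundedDefectAtTwo)
    (hInert : ∀ (W : WeierstrassCurve ℚ) [W.IsElliptic] [W.IsGloballyMinimal], ¬ W.HasCM →
      Rank1Residual.GoodOrd W 2 → (∀ m : ℕ, W.HasSurjectiveModNGaloisRep (2 ^ m : ℕ)) →
      ∀ (K : Type) [Field K] [NumberField K], IsImaginaryQuadratic K → ∀ [NeZero (W.conductorNorm ℤ)],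
      SatisfiesHeegnerHypothesis (W.conductorNorm ℤ) K → Odd (NumberField.discr K) → NumberField.discr K ≠ -3 →
      AddSubgroup.torsionBy (W.baseChange K).toAffine.Point (2 : ℤ) = ⊥ → ¬ SatisfiesHeegnerHypothesis 2 K →
      ∀ (Dt : ModularParametrizationData W (W.conductorNorm ℤ)) (β : ℤ) (ι : K →+* ℂ),
      (4 * (W.conductorNorm ℤ : ℤ)) ∣ β ^ 2 - NumberField.discr K →
      ∃ r : ℕ, ∀ θ k : ℕ, ∃ (n : ℕ) (d : KolyvaginHeegnerData Dt β ι n) (M : ℕ),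
        KolyvaginDescent.KolSupp (Zhang2014.IsKolyvaginPrime (W.conductorNorm ℤ) W K 2) n ∧
          n.primeFactors.card = r ∧ 1 ≤ M ∧ ((θ * M + k : ℕ) : ℕ∞) ≤ Zhang2014.levelIndex W 2 n ∧
          d.kolyvaginClass Nat.prime_two M ≠ 0) :
    ∀ (W : WeierstrassCurve ℚ) [W.IsElliptic] [W.IsGloballyMinimal], ¬ W.HasCM →
      (Rank1Residual.GoodOrd W 2 ∨ Rank1Residual.Mult W 2) →
      (∀ m : ℕ, W.HasSurjectiveModNGaloisRep (2 ^ m : ℕ)) →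
      ∀ (K : Type) [Field K] [NumberField K], IsImaginaryQuadratic K → NumberField.discr K ≠ -3 →
      NumberField.discr K ≠ -4 → ¬ ((2 : ℤ) ∣ NumberField.discr K) → ∀ [NeZero (W.conductorNorm ℤ)],
      SatisfiesHeegnerHypothesis (W.conductorNorm ℤ) K →
      ∀ (Dt : ModularParametrizationData W (W.conductorNorm ℤ)) (β : ℤ) (ι : K →+* ℂ) (n : ℕ)
        (d : KolyvaginHeegnerData Dt β ι n) (M : ℕ),
        KolyvaginDescent.KolSupp (Zhang2014.IsKolyvaginPrime (W.conductorNorm ℤ) W K 2) n →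
        1 ≤ M → (M : ℕ∞) ≤ Zhang2014.levelIndex W 2 n → d.kolyvaginClass Nat.prime_two M ≠ 0 →
        (∀ (n' : ℕ) (d' : KolyvaginHeegnerData Dt β ι n') (M' : ℕ),
          KolyvaginDescent.KolSupp (Zhang2014.IsKolyvaginPrime (W.conductorNorm ℤ) W K 2) n' →
          1 ≤ M' → (M' : ℕ∞) ≤ Zhang2014.levelIndex W 2 n' → d'.kolyvaginClass Nat.prime_two M' ≠ 0 →
          n.primeFactors.card ≤ n'.primeFactors.card) →
        1 ≤ n.primeFactors.card →
        (n.primeFactors.card + 1 ≤ W.selmerCorank 2 ∨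
          n.primeFactors.card + 1 ≤ (W.quadraticTwist (NumberField.discr K : ℚ)).selmerCorank 2) := by
  intro W _ _ hCM hred hsur K _ _ hK hne3 hne4 h2d _ hHN Dt β ι n d M hn hM1 hMle hne hmin hpos
  by_cases hH2 : SatisfiesHeegnerHypothesis 2 K
  · exact lowerBoundMinimalPosDepth_of_prop37_of_boundedDefect h37 hU1 W hCM hred hsur K hK hne3 hne4 h2d hHN
      hH2 Dt β ι n d M hn hM1 hMle hne hmin hpos
  · have hord : Rank1Residual.GoodOrd W 2 := by
      rcases hred with h | h
      · exact h
      · exact absurd (satisfiesHeegnerHypothesis_two_of_mult W h hHN) hH2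
    have hodd : Odd (NumberField.discr K) :=
      Int.not_even_iff_odd.mp fun h ↦ h2d (even_iff_two_dvd.mp h)
    have htor : AddSubgroup.torsionBy (W.baseChange K).toAffine.Point (2 : ℤ) = ⊥ :=
      noTwoTorsionOverK_proof W hsur K hK
    have hβ : (4 * (W.conductorNorm ℤ : ℤ)) ∣ β ^ 2 - NumberField.discr K := by exact_mod_cast d.dvd_sq_sub
    exact lowerBound_of_rich_of_exists_richDepth
      (KolyvaginLowerBoundAtTwo.KolyvaginCorankLowerBoundAtTwoRich_of_prop37 h37) W hCM hred hsur K hK hne3 hne4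
      h2d hHN Dt β ι (hInert W hCM hord hsur K hK hHN hodd hne3 htor hH2 Dt β ι hβ) n.primeFactors.card hmin

end Summit.BirchSwinnertonDyer.BirchSwinnertonDyer.Theorems.KolyvaginRankRigidity

end
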